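import Summits.QuantumFields.YangMills.Theorems.F4SubCurvatureDoorShortRootRigiditySchwarzReflection
import Mathlib
import HarnessLib

/-!
# The rational sectoral solid harmonics `E_d` of the trigonal-injectivity proof, their harmonicity, mirror symmetry, plane
# trace and MAGIC-POINT VALUES (crux ⟨stmt-QuantumFields-23035⟩ `F4SubCurvatureDoor.ShortRootRigidity`, stub :146
# `stub_oddModeRigidity`; §1-bis steps (1′)–(4′) data of the owner's paper proof `Cruxes/ShortRootRigidity/TrigonalInjectivity.md` v4)

Following §1-bis (ym-idea-3 g21): `ζ = e^{2πi/3}`, `ℓ_{d₀}·p = A(p) + ζ B(p)` with the RATIONAL linear forms `A = (2x₀ − x₁ − x₂)/3`,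
`B = (x₀ − 2x₁ + x₂)/3` (so `ℓ·(u,v,−u−v) = u − ζv`, `ℓ·(1,1,1) = 0`, `ℓ·ℓ = 0`).  Arithmetic in `R[ζ] = R ⊕ ζR`, `ζ² = −1 − ζ`, is done on PAIRS:
`zmul (a,b) (c,d) = (ac − bd, ad + bc − bd)`, `zpow`; `Re(a + ζb) = a − b/2`.  The sectoral solid harmonic of degree `6s` attached to `d₀ = (1,1,1)` is
`sect s := P − Q/2`, `(P, Q) = zpow (A, B) (6s)` — an explicit `MvPolynomial (Fin 3) ℝ` with rational coefficients (`E_{d₀} = Re (ℓ·p)^{6s}`);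
the other three diagonals are reached by one coordinate sign flip of the argument.

PROVED (Mathlib + the tree's `laplacian3` only):
* `laplacian3_sect : Δ (sect s) = 0` — via the pair Leibniz rule `zd_zmul`, `zd_zpow : ∂_i p^{n+1} = (n+1)·p^n·∂_i p` and ISOTROPY
  `sum_zmul_cg : Σ_i (∂_i ℓ)² = 0` in `ℝ[ζ]` (`Σ a_i² = Σ b_i²`, `2Σ a_i b_i = Σ b_i²`), whence `Σ_i ∂_i²(ℓ^{n+2}) = (n+2)(n+1) ℓ^n · 0`;
* `eval_sect_reflect` — `E(σ₁ x) = E(x)` for the reflection `σ₁` in `(1,1,1)^⊥` (A, B kill `(1,1,1)`);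
* `eval_sect_plane` — `E(u, v, −u−v) = Re (u − ζv)^{6s}` (the owner's `R_s(u,v)`), i.e. `(zpow (u,−v) (6s)).1 − ½ (zpow (u,−v) (6s)).2`;
* the MAGIC VALUES at `P = (2,1,3)` and `Q = σ₁P = (−2,−3,−1)` (with `piPow` = the recurrence `(2+√−3)^n = a_n + b_n√−3` of
  `Cruxes/ShortRootRigidity/TrigonalArithmetic.lean`, restated since a Theorems file may not import a Cruxes workfile):
  `eval_sect_P : E_{d₀}(P) = 1` (`ℓ·P = ζ`), `eval_sect_P' : E_{d₀}(2,1,−3) = a_{6s}` (= `E_{(1,1,−1)}(P)`; `ℓ·(2,1,−3) = 2 − ζ = π·(−ζ)`),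
  `eval_sect_Q'' : E_{d₀}(−2,3,−1) = a_{6s}` (= `E_{(1,−1,1)}(Q)`; `−2 − 3ζ = π̄·(−ζ)`), where `a_{6s} = A_s = Re(2+√−3)^{6s}` — so the
  two-reflection identity at `P` reads `2a(A_s − 1) = 0`, and `A_s ≠ 1` (anchor) gives `a = 0`.
Together with ✓`…SchwarzReflection.eval_reflect_eq_neg` (step (2′)) and ✓`…TwoReflections.eq_zero_of_odd_under_two_diagonal_reflections` (step (7′))
these are all the polynomial identities of §1-bis; what remains for `TrigonalInjectivity s` is the assembly in g75's typing.

HONEST LABEL: helper lemmas toward the algebraic half of :146; `OddModeRigidity`, ⟨23035⟩, ⟨23125⟩, R2d and the Yang–Mills mass gap remain OPEN;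
no summit is proved by a line. [folklore; owner's note §1-bis]
-/

noncomputable section

namespace Summit.QuantumFields.YangMills.Theorems.F4SubCurvatureDoorSectoralHarmonic

open MvPolynomial Finsupp
open Summit.QuantumFields.YangMills.Theorems.F4SubCurvatureDoorSchwarzReflection (laplacian3)

/-! ## Pair arithmetic in `R[ζ]`, `ζ² = −1 − ζ`: `(a, b) ↔ a + ζ b` -/

section Pair
variable {R : Type*} [CommRing R]

/-- Multiplication in `R[ζ]`, `ζ² = −1 − ζ`: `(a + ζb)(c + ζd) = (ac − bd) + ζ(ad + bc − bd)`. -/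
def zmul (p q : R × R) : R × R := (p.1 * q.1 - p.2 * q.2, p.1 * q.2 + p.2 * q.1 - p.2 * q.2)

/-- Powers in `R[ζ]`. -/
def zpow (p : R × R) : ℕ → R × R
  | 0 => (1, 0)
  | n + 1 => zmul (zpow p n) p

/-- `p^0 = 1`. -/
@[simp] theorem zpow_zero (p : R × R) : zpow p 0 = (1, 0) := rfl
/-- `p^{n+1} = p^n · p`. -/
theorem zpow_succ (p : R × R) (n : ℕ) : zpow p (n + 1) = zmul (zpow p n) p := rfl

/-- Commutativity. -/
theorem zmul_comm (p q : R × R) : zmul p q = zmul q p := by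
  unfold zmul; ext <;> ring

/-- Associativity. -/
theorem zmul_assoc (p q r : R × R) : zmul (zmul p q) r = zmul p (zmul q r) := by
  unfold zmul; ext <;> ring

/-- Middle-four interchange. -/
theorem zmul_zmul_zmul_comm (a b c d : R × R) : zmul (zmul a b) (zmul c d) = zmul (zmul a c) (zmul b d) := by
  unfold zmul; ext <;> ring

/-- Right unit. -/
@[simp] theorem zmul_one (p : R × R) : zmul p (1, 0) = p := by
  unfold zmul; ext <;> simp

/-- Left unit. -/
@[simp] theorem one_zmul (p : R × R) : zmul (1, 0) p = p := by
  unfold zmul; ext <;> simp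

/-- Left distributivity. -/
theorem zmul_add (p q r : R × R) : zmul p (q + r) = zmul p q + zmul p r := by
  unfold zmul; ext <;> simp <;> ring

/-- Right distributivity. -/
theorem add_zmul (p q r : R × R) : zmul (p + q) r = zmul p r + zmul q r := by
  unfold zmul; ext <;> simp <;> ring

/-- `p · 0 = 0`. -/
@[simp] theorem zmul_zero (p : R × R) : zmul p 0 = 0 := by
  unfold zmul; ext <;> simp

/-- `0 · p = 0`. -/
@[simp] theorem zero_zmul (p : R × R) : zmul 0 p = 0 := by
  unfold zmul; ext <;> simp

/-- `ℕ`-bilinearity (left). -/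
theorem zmul_nsmul (m : ℕ) (p q : R × R) : zmul (m • p) q = m • zmul p q := by
  unfold zmul; ext <;> simp <;> ring

/-- `ℕ`-bilinearity (right). -/
theorem zmul_nsmul' (m : ℕ) (p q : R × R) : zmul p (m • q) = m • zmul p q := by
  rw [zmul_comm, zmul_nsmul, zmul_comm]

/-- Distributivity over finite sums. -/
theorem zmul_sum {ι : Type*} (s : Finset ι) (p : R × R) (f : ι → R × R) :
    zmul p (∑ i ∈ s, f i) = ∑ i ∈ s, zmul p (f i) := by
  classical
  induction s using Finset.induction_on with
  | empty => simp
  | insert a s ha ih => rw [Finset.sum_insert ha, Finset.sum_insert ha, zmul_add, ih]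

/-- `p^{m+n} = p^m p^n`. -/
theorem zpow_add (p : R × R) (m n : ℕ) : zpow p (m + n) = zmul (zpow p m) (zpow p n) := by
  induction n with
  | zero => simp
  | succ n ih => rw [Nat.add_succ, zpow_succ, ih, zpow_succ, zmul_assoc]

/-- `p^{mn} = (p^m)^n`. -/
theorem zpow_mul (p : R × R) (m n : ℕ) : zpow p (m * n) = zpow (zpow p m) n := by
  induction n with
  | zero => simp
  | succ n ih => rw [Nat.mul_succ, zpow_add, ih, zpow_succ]

/-- `(pq)^n = p^n q^n`. -/
theorem zpow_zmul (p q : R × R) (n : ℕ) : zpow (zmul p q) n = zmul (zpow p n) (zpow q n) := by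
  induction n with
  | zero => simp
  | succ n ih => rw [zpow_succ, zpow_succ, zpow_succ, ih, zmul_zmul_zmul_comm]

/-- `1^n = 1`. -/
theorem zpow_one_zero (n : ℕ) : zpow ((1, 0) : R × R) n = (1, 0) := by
  induction n with
  | zero => rfl
  | succ n ih => rw [zpow_succ, ih, zmul_one]

/-- Transport of a pair along a ring hom. -/
def zmap {S : Type*} [CommRing S] (f : R →+* S) (p : R × R) : S × S := (f p.1, f p.2)

/-- `zmap` is multiplicative. -/
theorem zmap_zmul {S : Type*} [CommRing S] (f : R →+* S) (p q : R × R) : zmap f (zmul p q) = zmul (zmap f p) (zmap f q) := by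
  unfold zmap zmul; ext <;> simp

/-- `zmap` commutes with powers. -/
theorem zmap_zpow {S : Type*} [CommRing S] (f : R →+* S) (p : R × R) (n : ℕ) : zmap f (zpow p n) = zpow (zmap f p) n := by
  induction n with
  | zero => simp [zmap]
  | succ n ih => rw [zpow_succ, zpow_succ, zmap_zmul, ih]

end Pair

/-! ## Pair calculus for a partial derivative -/

/-- `∂_i` acting componentwise on pairs of polynomials. -/
def zd (i : Fin 3) (p : MvPolynomial (Fin 3) ℝ × MvPolynomial (Fin 3) ℝ) : MvPolynomial (Fin 3) ℝ × MvPolynomial (Fin 3) ℝ :=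
  (pderiv i p.1, pderiv i p.2)

/-- Additivity of `∂_i` on pairs. -/
theorem zd_add (i : Fin 3) (p q : MvPolynomial (Fin 3) ℝ × MvPolynomial (Fin 3) ℝ) : zd i (p + q) = zd i p + zd i q := by
  unfold zd; ext <;> simp

/-- `∂_i (m • p) = m • ∂_i p`. -/
theorem zd_nsmul (i : Fin 3) (m : ℕ) (p : MvPolynomial (Fin 3) ℝ × MvPolynomial (Fin 3) ℝ) : zd i (m • p) = m • zd i p := by
  unfold zd; ext <;> simp

/-- `∂_i` of a finite sum of pairs. -/
theorem zd_sum (i : Fin 3) {ι : Type*} (s : Finset ι) (f : ι → MvPolynomial (Fin 3) ℝ × MvPolynomial (Fin 3) ℝ) :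
    zd i (∑ j ∈ s, f j) = ∑ j ∈ s, zd i (f j) := by
  classical
  induction s using Finset.induction_on with
  | empty => simp [zd]
  | insert a s ha ih => rw [Finset.sum_insert ha, Finset.sum_insert ha, zd_add, ih]

/-- Leibniz rule for the pair product. -/
theorem zd_zmul (i : Fin 3) (p q : MvPolynomial (Fin 3) ℝ × MvPolynomial (Fin 3) ℝ) :
    zd i (zmul p q) = zmul (zd i p) q + zmul p (zd i q) := by
  unfold zd zmul
  ext <;> simp only [map_sub, map_add, Derivation.leibniz, smul_eq_mul, Prod.mk_add_mk] <;> ring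

/-- `∂_i (p^{n+1}) = (n+1) · p^n · ∂_i p`. -/
theorem zd_zpow (i : Fin 3) (p : MvPolynomial (Fin 3) ℝ × MvPolynomial (Fin 3) ℝ) (n : ℕ) :
    zd i (zpow p (n + 1)) = (n + 1) • zmul (zpow p n) (zd i p) := by
  induction n with
  | zero =>
    have h0 : zd i ((1, 0) : MvPolynomial (Fin 3) ℝ × MvPolynomial (Fin 3) ℝ) = 0 := by
      unfold zd; ext <;> simp
    rw [zpow_succ, zd_zmul, zpow_zero, one_zmul, h0, zero_zmul, zero_add, zero_add, one_smul]
  | succ n ih =>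
    rw [zpow_succ, zd_zmul, ih, zmul_nsmul, zmul_assoc, zmul_comm (zd i p) p, ← zmul_assoc, ← zpow_succ]
    simp only [succ_nsmul]

/-! ## The isotropic linear forms and the sectoral harmonic -/

/-- `A = (2x₀ − x₁ − x₂)/3`. -/
def linA : MvPolynomial (Fin 3) ℝ := C (2 / 3) * X 0 - C (1 / 3) * X 1 - C (1 / 3) * X 2
/-- `B = (x₀ − 2x₁ + x₂)/3`. -/
def linB : MvPolynomial (Fin 3) ℝ := C (1 / 3) * X 0 - C (2 / 3) * X 1 + C (1 / 3) * X 2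
/-- `∇A`. -/
def gA : Fin 3 → ℝ := ![2 / 3, -1 / 3, -1 / 3]
/-- `∇B`. -/
def gB : Fin 3 → ℝ := ![1 / 3, -2 / 3, 1 / 3]

/-- `∂_i A = (∇A)_i`. -/
theorem pderiv_linA (i : Fin 3) : pderiv i linA = C (gA i) := by
  fin_cases i <;> simp [linA, gA, pderiv_X, map_sub] <;> norm_num [map_neg]

/-- `∂_i B = (∇B)_i`. -/
theorem pderiv_linB (i : Fin 3) : pderiv i linB = C (gB i) := by
  fin_cases i <;> first | (simp [linB, gB, pderiv_X, map_sub, map_add]; done) | (simp [linB, gB, pderiv_X, map_sub, map_add]; norm_num [map_neg])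

/-- the basic pair `ℓ = (A, B)` and its constant gradient pairs -/
def ell : MvPolynomial (Fin 3) ℝ × MvPolynomial (Fin 3) ℝ := (linA, linB)
/-- The constant pair `∂_i ℓ`. -/
def cg (i : Fin 3) : MvPolynomial (Fin 3) ℝ × MvPolynomial (Fin 3) ℝ := (C (gA i), C (gB i))

/-- `∂_i ℓ = cg i`. -/
theorem zd_ell (i : Fin 3) : zd i ell = cg i := by
  unfold zd ell cg; rw [pderiv_linA, pderiv_linB]

/-- `∂_i (cg j) = 0`. -/
theorem zd_cg (i j : Fin 3) : zd i (cg j) = 0 := by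
  unfold zd cg; ext <;> simp

/-- ISOTROPY: `Σ_i (∂_i ℓ)² = 0` in `ℝ[ζ]`. -/
theorem sum_zmul_cg : ∑ i : Fin 3, zmul (cg i) (cg i) = 0 := by
  simp only [Fin.sum_univ_three, zmul, cg, gA, gB, Prod.mk_add_mk, Prod.mk_eq_zero]
  simp only [Matrix.cons_val_zero, Matrix.cons_val_one, Matrix.head_cons, Matrix.cons_val_two, Matrix.tail_cons]
  constructor <;>
  · simp only [← map_mul, ← map_sub, ← map_add]
    norm_num

/-- `(P_n, Q_n) ↔ (A + ζB)^n`. -/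
def PQ (n : ℕ) : MvPolynomial (Fin 3) ℝ × MvPolynomial (Fin 3) ℝ := zpow ell n

/-- second derivatives of the pair powers -/
theorem zd_zd_PQ (i : Fin 3) (n : ℕ) : zd i (zd i (PQ (n + 2))) = ((n + 2) * (n + 1)) • zmul (zpow ell n) (zmul (cg i) (cg i)) := by
  rw [PQ, zd_zpow, zd_ell, zd_nsmul, zd_zmul, zd_zpow, zd_ell, zd_cg, zmul_zero, add_zero, zmul_nsmul, zmul_assoc,
    ← mul_nsmul', mul_comm]

/-- `Δ ℓ^{n+2} = 0` (pair form). -/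
theorem sum_zd_zd_PQ (n : ℕ) : ∑ i : Fin 3, zd i (zd i (PQ (n + 2))) = 0 := by
  simp only [zd_zd_PQ]
  rw [← Finset.smul_sum, ← zmul_sum, sum_zmul_cg, zmul_zero, smul_zero]

/-- `P_n` is harmonic. -/
theorem laplacian3_PQ_fst (n : ℕ) : laplacian3 (PQ n).1 = 0 := by
  rcases n with _ | _ | n
  · simp [laplacian3, PQ]
  · have h : ∀ i : Fin 3, pderiv i (pderiv i (PQ 1).1) = 0 := by
      intro i
      have h1 : PQ 1 = ell := by rw [PQ, zpow_succ, zpow_zero, one_zmul]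
      rw [h1, ell, pderiv_linA, pderiv_C]
    simp [laplacian3, h]
  · have h := congrArg Prod.fst (sum_zd_zd_PQ n)
    simpa [laplacian3, zd, Prod.fst_sum] using h

/-- `Q_n` is harmonic. -/
theorem laplacian3_PQ_snd (n : ℕ) : laplacian3 (PQ n).2 = 0 := by
  rcases n with _ | _ | n
  · simp [laplacian3, PQ]
  · have h : ∀ i : Fin 3, pderiv i (pderiv i (PQ 1).2) = 0 := by
      intro i
      have h1 : PQ 1 = ell := by rw [PQ, zpow_succ, zpow_zero, one_zmul]
      rw [h1, ell, pderiv_linB, pderiv_C]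
    simp [laplacian3, h]
  · have h := congrArg Prod.snd (sum_zd_zd_PQ n)
    simpa [laplacian3, zd, Prod.snd_sum] using h

/-- `E_s = Re (A + ζB)^{6s} = P − Q/2`. -/
def sect (s : ℕ) : MvPolynomial (Fin 3) ℝ := (PQ (6 * s)).1 - C (1 / 2) * (PQ (6 * s)).2

/-- **`E_s` is harmonic.** -/
theorem laplacian3_sect (s : ℕ) : laplacian3 (sect s) = 0 := by
  have h1 := laplacian3_PQ_fst (6 * s)
  have h2 := laplacian3_PQ_snd (6 * s)
  simp only [laplacian3] at h1 h2 ⊢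
  simp only [sect, map_sub, pderiv_C_mul, Finset.sum_sub_distrib, ← Finset.mul_sum, h1, h2, mul_zero, sub_zero]


/-! ## Evaluation, mirror symmetry, plane trace -/

/-- the two linear forms as numbers -/
def Aval (x : Fin 3 → ℝ) : ℝ := 2 / 3 * x 0 - 1 / 3 * x 1 - 1 / 3 * x 2
/-- `B` as a number. -/
def Bval (x : Fin 3 → ℝ) : ℝ := 1 / 3 * x 0 - 2 / 3 * x 1 + 1 / 3 * x 2

/-- Evaluating `ℓ`. -/
theorem zmap_eval_ell (x : Fin 3 → ℝ) : zmap (eval x) ell = (Aval x, Bval x) := by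
  unfold zmap ell linA linB Aval Bval
  ext <;> simp

/-- Evaluating `ℓ^n`. -/
theorem eval_PQ (x : Fin 3 → ℝ) (n : ℕ) : ((eval x) (PQ n).1, (eval x) (PQ n).2) = zpow (Aval x, Bval x) n := by
  have h := zmap_zpow (eval x) ell n
  rw [zmap_eval_ell] at h
  exact h

/-- **Evaluating `E_s`**: `E_s(x) = Re (A(x) + ζB(x))^{6s}`. -/
theorem eval_sect (x : Fin 3 → ℝ) (s : ℕ) :
    eval x (sect s) = (zpow (Aval x, Bval x) (6 * s)).1 - 1 / 2 * (zpow (Aval x, Bval x) (6 * s)).2 := by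
  have h := eval_PQ x (6 * s)
  have h1 := congrArg Prod.fst h
  have h2 := congrArg Prod.snd h
  simp only at h1 h2
  simp [sect, h1, h2]

/-- `E` depends only on the projection to the plane: it is invariant under the reflection `σ₁` in `(1,1,1)^⊥`. -/
theorem eval_sect_reflect (x : Fin 3 → ℝ) (s : ℕ) :
    eval (fun i => x i - 2 / 3 * (x 0 + x 1 + x 2)) (sect s) = eval x (sect s) := by
  rw [eval_sect, eval_sect]
  have hA : Aval (fun i => x i - 2 / 3 * (x 0 + x 1 + x 2)) = Aval x := by simp [Aval]; ring
  have hB : Bval (fun i => x i - 2 / 3 * (x 0 + x 1 + x 2)) = Bval x := by simp [Bval]; ring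
  rw [hA, hB]

/-- Trace on the plane `x₀ + x₁ + x₂ = 0`, parametrised by `(u, v, −u−v)`: `E(u,v,−u−v) = Re (u − ζ v)^{6s}`. -/
theorem eval_sect_plane (u v : ℝ) (s : ℕ) :
    eval ![u, v, -u - v] (sect s) = (zpow (u, -v) (6 * s)).1 - 1 / 2 * (zpow (u, -v) (6 * s)).2 := by
  rw [eval_sect]
  have hA : Aval ![u, v, -u - v] = u := by simp [Aval]; ring
  have hB : Bval ![u, v, -u - v] = -v := by simp [Bval]; ring
  rw [hA, hB]

/-! ## The magic point: `P = (2,1,3)`, `Q = σ₁ P = (−2,−3,−1)` -/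

/-- `(2+√−3)^n = (piPow n).1 + (piPow n).2·√−3` (the recurrence of `Cruxes/ShortRootRigidity/TrigonalArithmetic.lean`, restated here because a
Theorems file may not import a Cruxes workfile). -/
def piPow : ℕ → ℤ × ℤ
  | 0 => (1, 0)
  | n + 1 => (2 * (piPow n).1 - 3 * (piPow n).2, (piPow n).1 + 2 * (piPow n).2)

/-- The recurrence. -/
theorem piPow_succ (n : ℕ) : piPow (n + 1) = (2 * (piPow n).1 - 3 * (piPow n).2, (piPow n).1 + 2 * (piPow n).2) := rfl

/-- `π^n` in `ζ`-coordinates: `π = 3 + 2ζ`. -/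
theorem zpow_pi (n : ℕ) : zpow ((3 : ℝ), 2) n = (((piPow n).1 : ℝ) + (piPow n).2, 2 * ((piPow n).2 : ℝ)) := by
  induction n with
  | zero => simp [piPow, zpow]
  | succ n ih =>
    rw [zpow_succ, ih, piPow_succ]
    unfold zmul
    push_cast
    ext <;> ring

/-- `π̄^n` in `ζ`-coordinates: `π̄ = 1 − 2ζ`. -/
theorem zpow_piBar (n : ℕ) : zpow ((1 : ℝ), -2) n = (((piPow n).1 : ℝ) - (piPow n).2, -2 * ((piPow n).2 : ℝ)) := by
  induction n with
  | zero => simp [piPow, zpow]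
  | succ n ih =>
    rw [zpow_succ, ih, piPow_succ]
    unfold zmul
    push_cast
    ext <;> ring

/-- `ζ^6 = 1`. -/
theorem zpow_zeta_six : zpow ((0 : ℝ), 1) 6 = (1, 0) := by
  simp [zpow_succ, zmul]

/-- `(−ζ)^6 = 1`. -/
theorem zpow_negZeta_six : zpow ((0 : ℝ), -1) 6 = (1, 0) := by
  simp [zpow_succ, zmul]

/-- `ζ^{6s} = 1`. -/
theorem zpow_zeta_six_mul (s : ℕ) : zpow ((0 : ℝ), 1) (6 * s) = (1, 0) := by
  rw [zpow_mul, zpow_zeta_six, zpow_one_zero]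

/-- `(−ζ)^{6s} = 1`. -/
theorem zpow_negZeta_six_mul (s : ℕ) : zpow ((0 : ℝ), -1) (6 * s) = (1, 0) := by
  rw [zpow_mul, zpow_negZeta_six, zpow_one_zero]

/-- `E_{d₀}(P) = 1` (`ℓ·P = ζ`). -/
theorem eval_sect_P (s : ℕ) : eval ![2, 1, 3] (sect s) = 1 := by
  rw [eval_sect]
  have hA : Aval ![2, 1, 3] = 0 := by simp [Aval]; norm_num
  have hB : Bval ![2, 1, 3] = 1 := by simp [Bval]; norm_num
  rw [hA, hB, zpow_zeta_six_mul]
  norm_num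

/-- `E_{d′}(P) = A_s` for `d′ = (1,1,−1)`: `E_{d′}(p) = E_{d₀}(p₀,p₁,−p₂)`, and `ℓ·(2,1,−3) = 2 − ζ = π·(−ζ)`. -/
theorem eval_sect_P' (s : ℕ) : eval ![2, 1, -3] (sect s) = (piPow (6 * s)).1 := by
  rw [eval_sect]
  have hA : Aval ![2, 1, -3] = 2 := by simp [Aval]; norm_num
  have hB : Bval ![2, 1, -3] = -1 := by simp [Bval]; norm_num
  have hfac : ((2 : ℝ), (-1 : ℝ)) = zmul ((3 : ℝ), 2) (0, -1) := by unfold zmul; norm_num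
  rw [hA, hB, hfac, zpow_zmul, zpow_negZeta_six_mul, zmul_one, zpow_pi]
  ring

/-- `E_{d″}(Q) = A_s` for `d″ = (1,−1,1)`, `Q = (−2,−3,−1)`: `E_{d″}(q) = E_{d₀}(q₀,−q₁,q₂)`, and `ℓ·(−2,3,−1) = −2 − 3ζ = π̄·(−ζ)`. -/
theorem eval_sect_Q'' (s : ℕ) : eval ![-2, 3, -1] (sect s) = (piPow (6 * s)).1 := by
  rw [eval_sect]
  have hA : Aval ![-2, 3, -1] = -2 := by simp [Aval]; norm_num
  have hB : Bval ![-2, 3, -1] = -3 := by simp [Bval]; norm_num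
  have hfac : ((-2 : ℝ), (-3 : ℝ)) = zmul ((1 : ℝ), -2) (0, -1) := by unfold zmul; norm_num
  rw [hA, hB, hfac, zpow_zmul, zpow_negZeta_six_mul, zmul_one, zpow_piBar]
  ring

end Summit.QuantumFields.YangMills.Theorems.F4SubCurvatureDoorSectoralHarmonic

end
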